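import Summits.Ventures.PercRepro.RankLevelSetExplicitLin2KeyL
import Summits.Ventures.PercRepro.RankLevelSetExplicitLin2IndepRow58FifteenA

/-!
# PercRepro — THE LEVEL-15 THEOREM-M ROW OF C-025 OVER THE 5/8 RANGE: THE KEY AT `p = 21 005` (p9, S4; the key is p4's)

`proofs/SUBCLAIM-S4-p9.md` §S4.2⁗⁗. p4's THEOREM-M key `KeyL 15 p d` (RankLevelSetExplicitLin2KeyL) checked by the kernel at
`p = 21 005` on the coranks `16 ≤ d ≤ 20495` of THE 5/8 RANGE (`D' = 15 + 5·2^{12} = 20495`; the large-corank theorem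
`c025_core_explicit_large_of58` takes the coranks beyond): `21 005` = the least `p` with the optimal Chernoff pair
`16·n^n ≤ 2^n·(n − K)^{n−K}·K^K` at `n = p + D'`, `K = 15 + D'` (twin lean-drafts/p9/g7/twin/range58.py), at or above the key's
own floor and the bases `N₁ = 20 687`, `P₂ = 20 527` (RankLevelSetExplicitLin2Bases58); p4's sharp row sits at `33 419`
(RankLevelSetExplicitLin2IndepFloorS). The level step and the unconditional chain are RankLevelSetExplicitLin2IndepFloor58.
Axioms: standard (kernel `decide`).
-/

namespace PercRepro

namespace ThmN

namespace Explicit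

/-- The THEOREM-M key row at `(q, p) = (15, 21 005)`, chunk 9 of 10: coranks `16400 … 18447`, by the kernel. -/
theorem key_fifteen_indep58_row_9 : ∀ t < 2048, KeyL 15 21005 (16 + (16384 + t)) := by decide +kernel

/-- The THEOREM-M key row at `(q, p) = (15, 21 005)`, chunk 10 of 10: coranks `18448 … 20495`, by the kernel. -/
theorem key_fifteen_indep58_row_10 : ∀ t < 2048, KeyL 15 21005 (16 + (18432 + t)) := by decide +kernel

/-- **THE THEOREM-M KEY ROW AT `(q, p) = (15, 21 005)` OVER THE 5/8 RANGE**: `KeyL 15 21005 d` at every corank `16 ≤ d ≤ 20495` (the 10 chunks). -/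
theorem key_fifteen_indep58_row : ∀ t < 20480, KeyL 15 21005 (16 + t) :=
  ball_lt_add (fun t => KeyL 15 21005 (16 + t)) 18432 2048
    (ball_lt_add (fun t => KeyL 15 21005 (16 + t)) 16384 2048
    (ball_lt_add (fun t => KeyL 15 21005 (16 + t)) 14336 2048
    (ball_lt_add (fun t => KeyL 15 21005 (16 + t)) 12288 2048
    (ball_lt_add (fun t => KeyL 15 21005 (16 + t)) 10240 2048
    (ball_lt_add (fun t => KeyL 15 21005 (16 + t)) 8192 2048
    (ball_lt_add (fun t => KeyL 15 21005 (16 + t)) 6144 2048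
    (ball_lt_add (fun t => KeyL 15 21005 (16 + t)) 4096 2048
    (ball_lt_add (fun t => KeyL 15 21005 (16 + t)) 2048 2048
    key_fifteen_indep58_row_1 key_fifteen_indep58_row_2) key_fifteen_indep58_row_3) key_fifteen_indep58_row_4) key_fifteen_indep58_row_5) key_fifteen_indep58_row_6) key_fifteen_indep58_row_7) key_fifteen_indep58_row_8) key_fifteen_indep58_row_9) key_fifteen_indep58_row_10

end Explicit

end ThmN

end PercRepro
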